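import Summits.BirchSwinnertonDyer.BirchSwinnertonDyer.Theorems.ByReductionTypeAtTwoMultUpperHalfTowerCert
import HarnessLib

/-!
# Route `ByReductionTypeAtTwo`, crux `MultUpperHalfAtTwo` (item stmt-BirchSwinnertonDyer-19922): the «ONE BIT AT A NON-SPLIT 2»
# binder of the TOWER road — a named MEMO-grade local statement (cell memo HOME/mult2/gen7/PROOF-NS2ONE.md), displayed, never proved here

HONEST FRAMING (cell `bsd-2adic`, run/shared/lean/pub/bsd-2adic/, seat `bsd-2adic-mult-2` GEN 7, HUMAN RULINGS D-0036 / D-0054 /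
D-0074): this file DECLARES ONE `Prop` (nothing asserted, no `sorry`, no axiom) — the hypothesis `hNS2one` of the one-bit tower class
files — exactly as `hNS2 = Greenberg1999.sec3_natCard_localTowerKerPrimary_le_four_nonsplitMultiplicative_two` (PRINT, Greenberg LNM 1716
p. 93: `#𝒦_{v,n}[2^∞] ≤ 4`) is displayed by the two-bit files. It is NOT print: Greenberg gives the ORDER `|ker(r_{v_n})| ~ 2c_v`; the
STRUCTURE (cyclic vs. `(ℤ/2)²`) is the cell memo PROOF-NS2ONE.md (elementary local Galois cohomology of the non-split Tate curve over
the local cyclotomic `ℤ₂`-tower: `H¹(Γ_n, U¹) ≅ ℤ/2` from Brauer groups, and the class `2c` of a lift of the unramified character is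
the norm residue symbol `(q, 2)_{ℚ₂}`), offered for referee scoring. MEMO-grade until a D-audit or a kernel proof.

THE STATEMENT. For a globally minimal elliptic `W/ℚ` with NON-SPLIT multiplicative reduction at `2` whose Tate unit satisfies
`u_q ≡ ±3 (mod 8)` — displayed decidably as `(Δ_min / 2^{ord₂ Δ_min}) · c₄ ≡ ±3 (mod 8)` (memo §6: `u_q ≡ u_Δ c₄ mod 8`) — the
`2`-torsion of the local tower kernel `𝒦_{v,n}[2^∞]` (`WeierstrassCurve.localTowerKerPrimary`, = Greenberg's `ker(r_{v_n})`) at the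
place `v ∣ 2` of EVERY layer `n ≥ 1` of the cyclotomic `ℤ₂`-extension is finite of order `≤ 2` (the kernel is `ℤ/2` or `ℤ/4`, never
`(ℤ/2)²`; for `u_q ≡ ±1 (mod 8)` it IS `(ℤ/2)²`, memo §5). CONSEQUENCE: the constant at `2` of the tower-gap certificates
(`MultTowerCert.towerGapAtTwo_of_layerSelmer_cert_atTwo`, hypothesis `h2`) is `C₂ = 2` on these classes instead of `4` — one bit —
which moves 100 NON-SPLIT `E[2]`-irreducible classes of item 19922 from margin `−1` to margin `0` (HOME mult2/gen7/NOTE-NS2-one-bit-question.md).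
References: R. Greenberg, LNM 1716 (1999), §3 pp. 85–93; J. Silverman, GTM 151 Ch. V; J.-P. Serre, Local Fields XIV; cell memo PROOF-NS2ONE.md.
-/

set_option autoImplicit false
-- the Theorems namespace of this sub repeats the summit name by design (D-0017 nested layout: Summit.<S>.<Sub>)
set_option linter.dupNamespace false

noncomputable section

open scoped Classical

open NumberField IsDedekindDomain WeierstrassCurve Literature.NumberTheory.EllipticCurves

namespace Summit.BirchSwinnertonDyer.BirchSwinnertonDyer.Theorems.MultTowerNS2

/-- **«One bit at a non-split 2» (MEMO binder `hNS2one`; cell memo PROOF-NS2ONE.md; NOT in print — Greenberg p. 93 prints the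
order `~ 2c_v` only).** For a globally minimal `W/ℚ`, multiplicative and NON-SPLIT at `2`, with `Δ_min = 2^k · u`, `c₄ = c` and
`u · c ≡ ±3 (mod 8)` (i.e. Tate unit `u_q ≡ ±3 mod 8`): for every cyclotomic `ℤ₂`-datum `κ`, the place `v ∣ 2` and every layer
`n ≥ 1`, the `2`-torsion of the local tower kernel `𝒦_{v,n}[2^∞]` is finite of order at most `2`. MEMO-grade (cell memo
PROOF-NS2ONE.md, seat bsd-2adic-mult-2 GEN 7); the printed source (Greenberg, LNM 1716, §3 pp. 86 and 93) gives the shape and the ORDER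
only — this is a route-posited binder, NOT a Literature fact. -/
def localTowerKerTwoTorsion_le_two_nonsplitTwo_of_tateUnit : Prop :=
  ∀ (W : WeierstrassCurve ℚ) [W.IsElliptic] [W.IsGloballyMinimal],
    W.HasMultiplicativeReductionAtPrime 2 → ¬ W.HasSplitMultiplicativeReductionAtPrime 2 →
    (∃ (k : ℕ) (u c : ℤ), W.minimalDiscriminantInt = 2 ^ k * u ∧ W.c₄ = (c : ℚ) ∧
      (u * c % 8 = 3 ∨ u * c % 8 = 5)) →
    ∀ (κ : ZpExtension ℚ 2), κ.IsCyclotomic →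
    ∀ v : HeightOneSpectrum (𝓞 ℚ), ((2 : ℕ) : 𝓞 ℚ) ∈ v.asIdeal →
      ∀ n : ℕ, 1 ≤ n →
        Finite {x : W.localTowerKerPrimary κ (v.adicCompletion ℚ) n // 2 • x = 0} ∧
          Nat.card {x : W.localTowerKerPrimary κ (v.adicCompletion ℚ) n // 2 • x = 0} ≤ 2

end Summit.BirchSwinnertonDyer.BirchSwinnertonDyer.Theorems.MultTowerNS2

end
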